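import Summits.BirchSwinnertonDyer.BirchSwinnertonDyer.Theorems.GenusKolyvaginAtTwoOffCutResidualAtTwoRSocleSelectionHeegnerSocleUnram
import Summits.BirchSwinnertonDyer.BirchSwinnertonDyer.Theorems.GenusKolyvaginAtTwoOffCutResidualAtTwoRSocleSelectionRealVisibleArchimedean
import Summits.BirchSwinnertonDyer.BirchSwinnertonDyer.Theorems.GenusKolyvaginAtTwoOffCutResidualAtTwoRSocleSelectionRealVisibleDescent
import Summits.BirchSwinnertonDyer.BirchSwinnertonDyer.Theorems.GenusKolyvaginAtTwoVisiblePairAtTwoLevelTransfer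
import HarnessLib

/-!
# Route `GenusKolyvaginAtTwo`, residual `OffCutResidualAtTwoR` (stmt-BirchSwinnertonDyer-31767), LINE 27 «socle_selection» —
# STUB S2a (HL) VERBATIM: NO NON-ZERO MULTIPLE OF THE LEVEL-RAISED HEEGNER CLASS IS PHANTOM

Seat `bsd-line-gk2-p4` g30 (cell `bsd-f1-sign2`), WIDTH-5 attach on route `GenusKolyvaginAtTwo` rev 59.  `--supports stmt-BirchSwinnertonDyer-31767 --as
helper`.  THEOREMS ONLY (no definition, no named fact, no `sorry`); standard axioms.  **BSD is NOT proved by this file; `OffCutResidualAtTwoR` is NOT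
proved; no item is closed.**  PRINT used: `MultPublishedInputsAtTwo` (ranks `0 + 1`), exactly as in LEAD gk2-p1 g25's (SOC).

* **`heegnerLift`** — the statement of the skeleton's `stub_heegnerLift` (LINE 27 v2.0, STUB S2a = the (HL) conjunct of the former S2) VERBATIM (binders
  and conclusion byte-for-byte; the pen may plug it as is): on the shallow `Δ > 0` Heegner frame with `#Sel₂(E) = 4`, for every level `M`, every
  `c : ℤ`: if `c • ι_{M→M+1} c_M(1) ∈ H¹(K, E[2^{M+1}])` is phantom over `K` (`[·, ρ] = 0` on `Γ_{K(E[2^{M+1}])}`) then it is `0`.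
  PROOF.  Levels `M ≤ M₀`: `c_M(1) = κ_{2^M}(P₀) = 2^{M₀} κ_{2^M}(Q₀) = 0` (gk2 `kolyvaginClass_one_two_eq_kummerMapTorsion`).  Levels `M ≥ M₀ + 1`:
  a non-zero `θ = c • ι c_M(1)` has a power-of-`2` multiple of order `2` inside the cyclic `2`-group `⟨ι c_M(1)⟩`, which by socle uniqueness is THE
  HEEGNER SOCLE `z = 2^{M−M₀−1} • ι c_M(1) = ι_{1→M+1} κ₂(Q₀)` (LEAD `pow_zsmul_kolyvaginClass_one_eq_torsionH1OfDvd_kummer`); phantom classes are stable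
  under multiples (`h1Eval_zsmul`), so `z` is phantom over `K`.  But `κ₂(Q₀) = res_K t` for the non-zero REAL-TRIVIAL `2`-Selmer class `t` of `E/ℚ`
  (LEAD's `h2K`-free frame: `natCard_realTrivial_eq_two'`, `realTrivial_iff_mem_primeTwist_selmerGroup_of_descAdmissible_or_unram`, capitulation
  `resTorsion_mem_range_kummer_of_mem_primeTwist_selmerGroup`, rank-one dichotomy), so `z = res_K (ι_{1→M+1} t)`; DESCENT (`…RealVisibleDescent`,
  `E(K)[2] = 0`) makes `ι t` phantom over `ℚ`; `ι t` is real-trivial (`torsionH1OfDvd_mem_torsionLocalKer`); and ★ `…RealVisibleArchimedean`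
  (`Δ > 0`, `ρ̄_{E,2^{M+1}}` onto, `M + 1 ≥ 2`) forces `ι t = 0`, contradicting `z ≠ 0`.
BSD is NOT proved by any of this.

WHY S2a IS A STUB AND NOT GROSS (4.4) (REF2 g68 rider, 2026-08-30): print's Kolyvagin restriction-injectivity `H¹(K, E[p^M]) ↪ H¹(K(E[p^M]), E[p^M])`
(Gross 1991 §4 (4.4)/§9, Lawson–Wuthrich 2016 Lemma 3 / Thm. 14) is for `p` ODD; at `p = 2` one has `H¹(Gal(K(E[2^{M+1}])/K), E[2^{M+1}]) ≠ 0` in general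
(`H¹(GL₂(ℤ/4), (ℤ/4)²) = ℤ/2`, Lawson–Wuthrich 2016 §7; the `−1`-homothety count), so phantom classes EXIST and (HL) is a statement about the particular
class `c • ι c_M(1)`, proved here from real visibility, not an instance of a vanishing `H¹`.

References: [LawsonWuthrich2016] Lemma 3, §7.1; [GrossLMS1991] §4 (4.4), §5 (5.1), §9; [McCallumLMS1991] §3 Prop. 3.1, §4 Lemma 4.6, §5 Lemma 5.1;
[Kramer1981] Thm. 1, §2 Prop. 6; [MazurRubin2007] §3.
-/

set_option autoImplicit false
-- the Theorems namespace of this sub repeats the summit name by design (D-0017 nested layout)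
set_option linter.dupNamespace false

noncomputable section

open scoped Classical

namespace Summit.BirchSwinnertonDyer.BirchSwinnertonDyer.Theorems.GenusExact.PlusDescent.SocleSelection

open WeierstrassCurve NumberField IsDedekindDomain Field
open Literature.NumberTheory.EllipticCurves Literature.NumberTheory.GaloisRepresentations
open Summit.BirchSwinnertonDyer.Rank1Residual.F1Sign2 (DescAdmissible DescAdmissibleUnram NoRationalTwoTorsion IsQuadraticCharacterOf)
open Summit.BirchSwinnertonDyer.BirchSwinnertonDyer.Theorems.GenusKolyArch
open Summit.BirchSwinnertonDyer.BirchSwinnertonDyer.Theorems.GenusSupplyNarrow.KFourPosCell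
open Summit.BirchSwinnertonDyer.BirchSwinnertonDyer.Theses.GenusKolyvaginAtTwo (MultPublishedInputsAtTwo)
open Literature.NumberTheory.EllipticCurves.ModularForms Literature.NumberTheory.EllipticCurves.KolyvaginCocycle

universe u

/-! ## §1 Socle bookkeeping in a `2`-group -/

/-- Socle uniqueness in a cyclic `2`-group: if `2^k • w` has order exactly `2` (`w` of `2`-power order), every `m • w` killed by `2` is `0`
or `2^k • w`.  (Same statement as the LINE 27 skeleton's / LEAD's private `zsmul_eq_zero_or_eq_socle`.) [folklore] -/
private theorem zsmul_eq_zero_or_eq_socle_hl {A : Type*} [AddCommGroup A] {n : ℕ} (w : A)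
    (hw : ((2 ^ n : ℕ) : ℤ) • w = 0) (k : ℕ) (hne : ((2 ^ k : ℕ) : ℤ) • w ≠ 0)
    (h2 : (2 : ℤ) • (((2 ^ k : ℕ) : ℤ) • w) = 0) (m : ℤ) (hm : (2 : ℤ) • (m • w) = 0) :
    m • w = 0 ∨ m • w = ((2 ^ k : ℕ) : ℤ) • w := by
  have ho : addOrderOf w ∣ 2 ^ n := by
    rw [natCast_zsmul] at hw
    exact addOrderOf_dvd_iff_nsmul_eq_zero.2 hw
  have hk : ¬ addOrderOf w ∣ 2 ^ k := by
    intro h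
    apply hne
    rw [natCast_zsmul]
    exact addOrderOf_dvd_iff_nsmul_eq_zero.1 h
  have hk1 : addOrderOf w ∣ 2 ^ (k + 1) := by
    apply addOrderOf_dvd_iff_nsmul_eq_zero.2
    have h2' : (2 : ℕ) • (((2 ^ k : ℕ) : ℤ) • w) = 0 := by
      rw [two_nsmul]; rw [two_zsmul] at h2; exact h2
    rw [natCast_zsmul] at h2'
    rw [pow_succ', mul_smul]
    exact h2'
  obtain ⟨e, -, hoe⟩ := (Nat.dvd_prime_pow Nat.prime_two).1 ho
  rw [hoe] at hk hk1
  rw [Nat.pow_dvd_pow_iff_le_right (by norm_num)] at hk hk1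
  have he : e = k + 1 := by omega
  -- `m • w` killed by `2` ⇒ `2m • w = 0` ⇒ `2^(k+1) ∣ 2m` ⇒ `2^k ∣ m`
  have h2m : addOrderOf w ∣ (2 * m).natAbs := by
    apply addOrderOf_dvd_iff_nsmul_eq_zero.2
    have h : (2 * m) • w = 0 := by rw [mul_smul]; exact hm
    rw [← natCast_zsmul]
    rcases Int.natAbs_eq (2 * m) with h' | h'
    · rw [← h']; exact h
    · rw [show (((2 * m).natAbs : ℕ) : ℤ) = -(2 * m) by omega, neg_smul, h, neg_zero]
  rw [hoe, he, Int.natAbs_mul, show (2 : ℤ).natAbs = 2 from rfl, pow_succ'] at h2m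
  have hkm : 2 ^ k ∣ m.natAbs := Nat.dvd_of_mul_dvd_mul_left (by norm_num) h2m
  obtain ⟨m', hm'⟩ : ((2 ^ k : ℕ) : ℤ) ∣ m := Int.natCast_dvd.2 hkm
  rw [hm']
  -- `σ := 2^k • w` has order `2`: `m' • σ ∈ {0, σ}` by parity of `m'`
  have hσ : ((2 ^ k : ℕ) : ℤ) • w + ((2 ^ k : ℕ) : ℤ) • w = 0 := by
    rw [← two_zsmul]; exact h2
  have hmw : (((2 ^ k : ℕ) : ℤ) * m') • w = m' • (((2 ^ k : ℕ) : ℤ) • w) := by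
    rw [mul_comm, mul_smul]
  rw [hmw]
  rcases Int.even_or_odd m' with ⟨r, hr⟩ | ⟨r, hr⟩
  · left
    rw [hr, add_smul, ← smul_add, hσ, smul_zero]
  · right
    rw [hr, add_smul, one_smul, mul_smul, two_zsmul, ← smul_add, hσ, smul_zero, zero_add]

/-- The socle index of a non-zero element of a `2`-group: some `2^i • y` is non-zero and killed by `2`. [folklore] -/
private theorem exists_pow_zsmul_ne_zero_and_two_zsmul {A : Type*} [AddCommGroup A] {n : ℕ} (y : A)
    (hy : ((2 ^ n : ℕ) : ℤ) • y = 0) (hy0 : y ≠ 0) :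
    ∃ i : ℕ, ((2 ^ i : ℕ) : ℤ) • y ≠ 0 ∧ (2 : ℤ) • (((2 ^ i : ℕ) : ℤ) • y) = 0 := by
  have hex : ∃ t : ℕ, ((2 ^ t : ℕ) : ℤ) • y = 0 := ⟨n, hy⟩
  have ht0 : Nat.find hex ≠ 0 := by
    intro h
    have hspec := Nat.find_spec hex
    rw [h, pow_zero, Nat.cast_one, one_smul] at hspec
    exact hy0 hspec
  obtain ⟨i, hi⟩ : ∃ i, Nat.find hex = i + 1 := ⟨Nat.find hex - 1, (Nat.succ_pred_eq_of_ne_zero ht0).symm⟩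
  refine ⟨i, Nat.find_min hex (show i < Nat.find hex by omega), ?_⟩
  rw [smul_smul, show (2 : ℤ) * ((2 ^ i : ℕ) : ℤ) = ((2 ^ (i + 1) : ℕ) : ℤ) by push_cast; ring, ← hi]
  exact Nat.find_spec hex

/-! ## §2 LINE 27 STUB S2a (HL), VERBATIM -/

/-- **LINE 27 STUB S2a (HL) — no non-zero multiple of the level-raised Heegner class is phantom** (statement of the skeleton's `stub_heegnerLift`
VERBATIM).  On `hP`'s output frame (`Δ(E) > 0`, `ρ̄_{E,2^n}` onto for all `n ≥ 1`, `C(E)` odd, `K` Heegner imaginary quadratic with odd `d_K ≠ -3`,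
minimal twin `Wd ≅ E^{(d_K)}` of analytic rank `1` with `#Sel₂(Wd) = 2`, `ord₂ C(Wd) = 0`, `#Sel₂(E) = 4`, print `MultPublishedInputsAtTwo`), for every
level `M`, every change-of-level proof `hdvd : 2^M ∣ 2^{M+1}` and every `c : ℤ`: if `c • ι c_M(1)` is phantom over `K` then `c • ι c_M(1) = 0`.
Levels `M ≤ M₀`: `c_M(1) = 2^{M₀} κ_{2^M}(Q₀) = 0`.  Levels `M ≥ M₀ + 1`: the socle of a non-zero `c • ι c_M(1)` is the Heegner socle
`ι_{1→M+1} κ₂(Q₀) = res_K (ι t)` (`t` the non-zero real-trivial `2`-Selmer class of `E/ℚ`), phantom over `K`, hence `ι t` is phantom over `ℚ`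
(descent, `E(K)[2] = 0`), real-trivial, and therefore `0` by the archimedean visibility theorem `RealVisible.eq_zero_of_phantom_of_mem_torsionLocalKer_rat`
(`Δ > 0`, `M + 1 ≥ 2`, `ρ̄_{E,2^{M+1}}` onto) — contradiction.  BSD is NOT proved by this; `OffCutResidualAtTwoR` is NOT proved.
[cite: LawsonWuthrich2016, Lemma 3, §7.1] [cite: GrossLMS1991, §4 (4.4), §9] [cite: McCallumLMS1991, §3 Prop. 3.1, §4 Lemma 4.6, §5 Lemma 5.1]
[cite: Kramer1981, Thm. 1, §2 Prop. 6] -/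
theorem heegnerLift :
    ∀ (W : WeierstrassCurve ℚ) [W.IsElliptic] [W.IsGloballyMinimal] [NeZero (W.conductorNorm ℤ)],
      W.analyticRank = 0 → (∀ n : ℕ, 0 < n → W.HasSurjectiveModNGaloisRep ((2 : ℤ) ^ n)) → Odd W.tamagawaProduct → 0 < W.Δ →
      ∀ (K : Type) [Field K] [NumberField K], IsImaginaryQuadratic K → Odd (NumberField.discr K) → NumberField.discr K ≠ -3 →
        SatisfiesHeegnerHypothesis (W.conductorNorm ℤ) K →
        ¬ IsSquare ((NumberField.discr K : ℚ) * -|W.Δ|) → ¬ IsSquare ((NumberField.discr K : ℚ) * (-(2 * |W.Δ|))) →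
      ∀ (Dt : ModularParametrizationData W (W.conductorNorm ℤ)),
        (∀ z ∈ Dt.L.lattice, ∃ w ∈ periodLattice Dt.f, z = (Dt.c : ℂ) * w) → Odd Dt.c →
      ∀ (β : ℤ) (ι : K →+* ℂ) (d₁ : KolyvaginHeegnerData Dt β ι 1), ¬ IsOfFinAddOrder d₁.derivedPoint →
      ∀ (M₀ : ℕ), (∃ Q : (W.baseChange (ringClassField K ι 1)).toAffine.Point, ((2 ^ M₀ : ℕ) : ℤ) • Q = d₁.derivedPoint) →
        (¬ ∃ Q : (W.baseChange (ringClassField K ι 1)).toAffine.Point, ((2 ^ (M₀ + 1) : ℕ) : ℤ) • Q = d₁.derivedPoint) →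
      ∀ (Wd : WeierstrassCurve ℚ) [Wd.IsElliptic] [Wd.IsGloballyMinimal],
        (∃ C : WeierstrassCurve.VariableChange ℚ, C • W.quadraticTwist (NumberField.discr K : ℚ) = Wd) →
        Wd.analyticRank = 1 → Nat.card (Wd.selmerGroup 2) = 2 → padicValNat 2 Wd.tamagawaProduct = 0 →
      Nat.card (W.selmerGroup 2) = 4 → MultPublishedInputsAtTwo →
      -- (HL)
      (∀ (M : ℕ) (hdvd : ((2 ^ M : ℕ) : ℤ) ∣ ((2 ^ (M + 1) : ℕ) : ℤ)) (c : ℤ),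
          (∀ ρ ∈ torsionFixing (W.baseChange K) ((2 ^ (M + 1) : ℕ) : ℤ), h1Eval (W.baseChange K) ((2 ^ (M + 1) : ℕ) : ℤ)
              (c • torsionH1OfDvd (W.baseChange K) hdvd (d₁.kolyvaginClass Nat.prime_two M)) ρ = 0) →
          c • torsionH1OfDvd (W.baseChange K) hdvd (d₁.kolyvaginClass Nat.prime_two M) = 0) := by
  intro W _ _ _ hr0 hρ hTam hpos K _ _ hIQ hodd _h3 hHe _hsq1 _hsq2 Dt _hopt _hc β ι d₁ _hy M₀ hdiv hndiv Wd _ _ hWd hrd hSel hDEF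
    h4 hGZK M hdvd c hph
  haveI : (W.baseChange K).IsElliptic := inferInstanceAs (W.map (algebraMap ℚ K)).IsElliptic
  have h2 : Module.finrank ℚ K = 2 := hIQ.1
  obtain ⟨ϑ, hϑ, hϑc⟩ := exists_sq_eq_discr_not_mem_range K h2
  have hsurj1 : W.HasSurjectiveModNGaloisRep ((2 : ℤ) ^ 1) := hρ 1 one_pos
  have hρ2 : W.HasSurjectiveModNGaloisRep 2 := by simpa using hsurj1
  have hT : NoRationalTwoTorsion W := GenusKolyTwin.noRationalTwoTorsion_of_hasSurjectiveModNGaloisRep W hsurj1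
  obtain ⟨Cd, hCd⟩ := hWd
  obtain ⟨χ, hχ⟩ := GenusKolyTransp.quadraticCharacterExists_holds (discr K)
  -- ranks from print: `rank E(ℚ) = 0`, `rank Wd(ℚ) = 1`, hence `rank E(K) = 1`
  have hrkW : W.mordellWeilRank = 0 := by rw [(hGZK W (by rw [hr0]; exact zero_le_one)).1, hr0]
  have hrkWd : Wd.mordellWeilRank = 1 := by rw [(hGZK Wd (by rw [hrd])).1, hrd]
  have hrkTw : (W.quadraticTwist (discr K : ℚ)).mordellWeilRank = 1 := by
    rw [← mordellWeilRank_variableChange_holds (W.quadraticTwist (discr K : ℚ)) Cd, hCd, hrkWd]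
  have hrkK : (W.baseChange K).mordellWeilRank = 1 := by
    rw [mordellWeilRank_baseChange_eq_add_of_sq_eq W K h2 hϑ hϑc, hrkW, hrkTw]
  -- `E(K)[2] = 0`
  have hbotK : AddSubgroup.torsionBy (W.baseChange K).toAffine.Point (2 : ℤ) = ⊥ :=
    torsionBy_two_baseChange_eq_bot_of_hasSurjectiveModNGaloisRep_two_of_isImaginaryQuadratic W hρ2 K hIQ
  have h2Kt : ∀ T : (W.baseChange K).toAffine.Point, (2 : ℤ) • T = 0 → T = 0 := fun T hT2 ↦ by
    have hmem : T ∈ AddSubgroup.torsionBy (W.baseChange K).toAffine.Point (2 : ℤ) := (Submodule.mem_torsionBy_iff _ T).mpr hT2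
    rw [hbotK] at hmem
    exact AddSubgroup.mem_bot.mp hmem
  -- the frame's descent-admissible dichotomy; the Heegner point `P₀ ∈ E(K)` under `P(1)`, `Q₀ = P₀/2^{M₀} ∉ 2E(K)` (as in LEAD's (SOC))
  have hd := descAdmissible_or_unram_of_shallowTwin W hIQ hodd hHe hTam Cd hCd hDEF
  have hdneg : (discr K : ℚ) < 0 := by exact_mod_cast IsImaginaryQuadratic.discr_neg hIQ
  have hsqΔ : ¬ IsSquare ((NumberField.discr K : ℚ) * W.Δ) := by
    rintro ⟨r, hr⟩
    nlinarith [mul_self_nonneg r, mul_neg_of_neg_of_pos hdneg hpos]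
  have htors1 : ∀ T : (W.baseChange (ringClassField K ι 1)).toAffine.Point, (2 : ℤ) • T = 0 → T = 0 := by
    intro T hT
    have h := GenusExact.torsionBy_two_ringClassField_eq_bot W hIQ ι one_ne_zero hρ2 hsqΔ
    have hT' : T ∈ AddSubgroup.torsionBy (W.baseChange (ringClassField K ι 1)).toAffine.Point ((2 : ℕ) : ℤ) :=
      (Submodule.mem_torsionBy_iff _ T).mpr (by exact_mod_cast hT)
    rw [h] at hT'
    exact (AddSubgroup.mem_bot).mp hT'
  obtain ⟨P₀, -, hP₀⟩ := heegnerSystem_exists_isHeegnerPoint_map_eq_derivedPoint_one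
    (heegnerPointOfConductor_one_galoisConj_holds (W.conductorNorm ℤ) W K) hIQ hHe d₁
  have hdivK : ∃ Q₀ : (W.baseChange K).toAffine.Point, ((2 ^ M₀ : ℕ) : ℤ) • Q₀ = P₀ := by
    obtain ⟨Q, hQ⟩ := hdiv
    obtain ⟨Q₀, hQ₀⟩ := (McCallum1991.exists_pow_smul_eq_derivedPoint_one_iff hIQ d₁ (p := 2) htors1 hP₀ M₀).mp
      ⟨Q, by simpa only [Nat.cast_pow, Nat.cast_ofNat] using hQ⟩
    exact ⟨Q₀, by simpa only [Nat.cast_pow, Nat.cast_ofNat] using hQ₀⟩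
  have hndivK : ¬ ∃ Q₁ : (W.baseChange K).toAffine.Point, ((2 ^ (M₀ + 1) : ℕ) : ℤ) • Q₁ = P₀ := by
    rintro ⟨Q₁, hQ₁⟩
    refine hndiv ?_
    obtain ⟨Q, hQ⟩ := (McCallum1991.exists_pow_smul_eq_derivedPoint_one_iff hIQ d₁ (p := 2) htors1 hP₀ (M₀ + 1)).mpr
      ⟨Q₁, by simpa only [Nat.cast_pow, Nat.cast_ofNat] using hQ₁⟩
    exact ⟨Q, by simpa only [Nat.cast_pow, Nat.cast_ofNat] using hQ⟩
  obtain ⟨Q₀, hQ₀⟩ := hdivK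
  have hQ₀nd : ¬ ∃ R : (W.baseChange K).toAffine.Point, (2 : ℤ) • R = Q₀ := by
    rintro ⟨R, hR⟩
    refine hndivK ⟨R, ?_⟩
    have h22 : ((2 ^ (M₀ + 1) : ℕ) : ℤ) = ((2 ^ M₀ : ℕ) : ℤ) * 2 := by push_cast; ring
    rw [h22, mul_smul, hR, hQ₀]
  by_contra hθ
  rcases Nat.lt_or_ge M (M₀ + 1) with hlt | hM
  · -- SHALLOW LEVELS `M ≤ M₀`: `c_M(1) = κ_{2^M}(P₀) = 2^{M₀} • κ_{2^M}(Q₀) = 0`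
    apply hθ
    have hc1 := GenusExact.VisiblePairAtTwo.kolyvaginClass_one_two_eq_kummerMapTorsion W K hIQ hodd hHe hsurj1 M d₁ P₀ hP₀
    have hzero : d₁.kolyvaginClass Nat.prime_two M = 0 := by
      rw [hc1, ← hQ₀, map_zsmul]
      obtain ⟨e, he⟩ : ((2 ^ M : ℕ) : ℤ) ∣ ((2 ^ M₀ : ℕ) : ℤ) :=
        GenusExact.KolyvaginClassLevels.natCast_pow_dvd_natCast_pow (by omega)
      have hκ : ((2 ^ M : ℕ) : ℤ) • kummerMapTorsion (W.baseChange K) ((2 ^ M : ℕ) : ℤ)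
          ((W.baseChange K).zsmul_geomPoints_surjective_of_charZero (by exact_mod_cast pow_ne_zero M two_ne_zero)) Q₀ = 0 :=
        zsmul_galH1Torsion_eq_zero (W.baseChange K) ((2 ^ M : ℕ) : ℤ) _
      rw [he, mul_comm, mul_smul, hκ, zsmul_zero]
    rw [hzero, map_zero, zsmul_zero]
  · -- DEEP LEVELS `M ≥ M₀ + 1`
    have h1 : ((2 : ℕ) : ℤ) ∣ ((2 ^ (M + 1) : ℕ) : ℤ) := by
      rw [pow_succ]; push_cast; exact Dvd.intro_left _ rfl
    -- the non-zero REAL-TRIVIAL `2`-Selmer class `t` of `E/ℚ` and its capitulation `res_K t = κ₂(Q₀)`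
    have hcard := natCard_realTrivial_eq_two' W hpos hρ2 hTam h4 hIQ hodd hHe Cd hCd hDEF hSel
    have h0mem : (0 : galH1Torsion W ((2 : ℕ) : ℤ)) ∈ W.selmerGroup ((2 : ℕ) : ℤ) ∧
        ∀ w : InfinitePlace ℚ, (0 : galH1Torsion W ((2 : ℕ) : ℤ)) ∈ W.torsionLocalKer w.Completion ((2 : ℕ) : ℤ) :=
      ⟨AddSubgroup.zero_mem _, fun w ↦ AddSubgroup.zero_mem _⟩
    obtain ⟨t, ht, -⟩ := (Nat.card_eq_two_iff' (⟨0, h0mem⟩ : {s : galH1Torsion W ((2 : ℕ) : ℤ) //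
        s ∈ W.selmerGroup ((2 : ℕ) : ℤ) ∧ ∀ w : InfinitePlace ℚ, s ∈ W.torsionLocalKer w.Completion ((2 : ℕ) : ℤ)})).mp hcard
    have ht0 : (t : galH1Torsion W ((2 : ℕ) : ℤ)) ≠ 0 := fun h ↦ ht (Subtype.ext h)
    have htT : (t : galH1Torsion W ((2 : ℕ) : ℤ)) ∈ PrimeTwist.selmerGroup W χ :=
      (realTrivial_iff_mem_primeTwist_selmerGroup_of_descAdmissible_or_unram W hpos hρ2 h4 hd Cd hCd hSel hχ _).mp t.2
    obtain ⟨Q', hQ'⟩ := resTorsion_mem_range_kummer_of_mem_primeTwist_selmerGroup W (K := K) hT (NumberField.discr_ne_zero K)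
      ⟨ϑ, hϑc⟩ Cd hCd hrkWd hSel hχ htT
    have hresne : resTorsion W K ((2 : ℕ) : ℤ) (t : galH1Torsion W ((2 : ℕ) : ℤ)) ≠ 0 := fun h0 ↦ ht0
      (GenusExact.EigenClassesFinite.resTorsion_injective_of_noTorsion W K h2 hϑ hϑc ((2 : ℕ) : ℤ) h2Kt (by rw [h0, map_zero]))
    have hrest : resTorsion W K ((2 : ℕ) : ℤ) (t : galH1Torsion W ((2 : ℕ) : ℤ)) =
        kummerMapTorsion (W.baseChange K) ((2 : ℕ) : ℤ) (hdiv_two_baseChange W K) Q₀ := by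
      rcases kummerMapTorsion_eq_zero_or_eq_of_rank_one W K hrkK h2Kt hQ₀nd Q' with h0 | h1'
      · exact absurd (hQ'.symm.trans h0) hresne
      · rw [← hQ', h1']
    -- the Heegner socle `z = 2^(M−M₀−1) • ι c_M(1) = ι_{1→M+1} κ₂(Q₀) = res_K (ι t)`, `z ≠ 0`, `2z = 0`
    set z : galH1Torsion (W.baseChange K) ((2 ^ (M + 1) : ℕ) : ℤ) :=
      torsionH1OfDvd (W.baseChange K) h1 (kummerMapTorsion (W.baseChange K) ((2 : ℕ) : ℤ) (hdiv_two_baseChange W K) Q₀) with hz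
    have hheeg := pow_zsmul_kolyvaginClass_one_eq_torsionH1OfDvd_kummer W hIQ hodd hHe hsurj1 d₁ hP₀ hQ₀ hM hdvd h1
    have hzres : z = resTorsion W K ((2 ^ (M + 1) : ℕ) : ℤ) (torsionH1OfDvd W h1 (t : galH1Torsion W ((2 : ℕ) : ℤ))) := by
      rw [GenusExact.SelmerDescent.resTorsion_torsionH1OfDvd W K h1, hrest]
    have hz0 : z ≠ 0 := by
      intro h0
      have hbot' : AddSubgroup.torsionBy (W.baseChange K).toAffine.Point ((2 : ℕ) : ℤ) = ⊥ := hbotK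
      have h1' : ((2 ^ 1 : ℕ) : ℤ) ∣ ((2 ^ (M + 1) : ℕ) : ℤ) := by simpa only [pow_one] using h1
      have hinj := GenusExact.VisiblePairAtTwo.torsionH1OfDvd_pow_injective (W.baseChange K) (p := 2) hbot' h1'
      apply hresne
      apply hinj
      rw [map_zero, hrest]
      exact h0
    have hz2 : (2 : ℤ) • z = 0 := by
      rw [hz, ← map_zsmul, show (2 : ℤ) • kummerMapTorsion (W.baseChange K) ((2 : ℕ) : ℤ) (hdiv_two_baseChange W K) Q₀ = 0 from
        zsmul_galH1Torsion_eq_zero (W.baseChange K) _ _, map_zero]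
    -- the socle of `θ = c • ι c_M(1)` is `z`
    have hθ0 : ((2 ^ (M + 1) : ℕ) : ℤ) • (c • torsionH1OfDvd (W.baseChange K) hdvd (d₁.kolyvaginClass Nat.prime_two M)) = 0 :=
      zsmul_galH1Torsion_eq_zero (W.baseChange K) ((2 ^ (M + 1) : ℕ) : ℤ) _
    obtain ⟨i, hine, hi2⟩ := exists_pow_zsmul_ne_zero_and_two_zsmul (n := M + 1)
      (c • torsionH1OfDvd (W.baseChange K) hdvd (d₁.kolyvaginClass Nat.prime_two M)) hθ0 hθ
    have hG0 : ((2 ^ (M + 1) : ℕ) : ℤ) • torsionH1OfDvd (W.baseChange K) hdvd (d₁.kolyvaginClass Nat.prime_two M) = 0 :=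
      zsmul_galH1Torsion_eq_zero (W.baseChange K) ((2 ^ (M + 1) : ℕ) : ℤ) _
    have hsoc : ((2 ^ i : ℕ) : ℤ) • (c • torsionH1OfDvd (W.baseChange K) hdvd (d₁.kolyvaginClass Nat.prime_two M)) = z := by
      rcases zsmul_eq_zero_or_eq_socle_hl _ hG0 (M - (M₀ + 1)) (by rw [hheeg]; exact hz0) (by rw [hheeg]; exact hz2)
        (((2 ^ i : ℕ) : ℤ) * c) (by rw [mul_smul]; exact hi2) with h0 | h1'
      · rw [mul_smul] at h0
        exact absurd h0 hine
      · rw [smul_smul, h1', hheeg]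
    -- `z` is phantom over `K` (multiples of phantom classes are phantom)
    have hzph : ∀ ρ ∈ torsionFixing (W.baseChange K) ((2 ^ (M + 1) : ℕ) : ℤ),
        h1Eval (W.baseChange K) ((2 ^ (M + 1) : ℕ) : ℤ) z ρ = 0 := fun ρ hρ' ↦ by
      rw [← hsoc, h1Eval_zsmul _ _ _ _ hρ', hph ρ hρ', smul_zero]
    -- descent: `ι t` is phantom over `ℚ`
    have hE2 : ∀ T : geomTorsion W ((2 ^ (M + 1) : ℕ) : ℤ), (2 : ℤ) • T = 0 →
        (∀ γ : absoluteGaloisGroup ℚ, γ • T = T) → T = 0 :=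
      fun T h2T hfix ↦ RealVisible.geomTorsion_eq_zero_of_forall_smul_eq W K hbotK T h2T hfix
    have hphQ := RealVisible.forall_h1Eval_eq_zero_of_resTorsion W K h2 ((2 ^ (M + 1) : ℕ) : ℤ) hE2
      (torsionH1OfDvd W h1 (t : galH1Torsion W ((2 : ℕ) : ℤ))) (by rw [← hzres]; exact hzph)
    -- `ι t` is real-trivial
    have hreal : torsionH1OfDvd W h1 (t : galH1Torsion W ((2 : ℕ) : ℤ)) ∈
        W.torsionLocalKer (Rat.infinitePlace).Completion ((2 ^ (M + 1) : ℕ) : ℤ) :=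
      GenusExact.VisiblePairAtTwo.torsionH1OfDvd_mem_torsionLocalKer W _ h1 (t.2.2 Rat.infinitePlace)
    -- ★ archimedean visibility: `ι t = 0`
    have hsurjM : W.HasSurjectiveModNGaloisRep ((2 ^ (M + 1) : ℕ) : ℤ) := by exact_mod_cast hρ (M + 1) (Nat.succ_pos M)
    have hzeroQ := RealVisible.eq_zero_of_phantom_of_mem_torsionLocalKer_rat W hpos M (by omega) hsurjM Rat.infinitePlace hphQ hreal
    exact hz0 (by rw [hzres, hzeroQ, map_zero])

end Summit.BirchSwinnertonDyer.BirchSwinnertonDyer.Theorems.GenusExact.PlusDescent.SocleSelection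

end
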